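import Literature.AnabelianGeometry.EtaleTheta.TemperedFrobenioidProps
import Literature.AnabelianGeometry.EtaleTheta.TemperedFrobenioidToyFinv
import Literature.AnabelianGeometry.EtaleTheta.Discharge.Sec3Remark363
import Literature.AlgebraicGeometry.Frobenioids.PadicFrobenioidQpSplit
import HarnessLib

/-!
# [EtTh] §3: the universal closures of the parametrised rows `Remark363`, `Thm37_ii` of
# `TemperedFrobenioidProps.lean` are FALSE; positive instances; Cor. 3.8 rows at `Ψ = 𝟭`

S. Mochizuki, *The étale theta function and its Frobenioid-theoretic manifestations*, Publ. RIMS **45**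
(2009) 227–349 [MochizukiEtTh2009], §3: Remark 3.6.3 (PDF p. 79), Theorem 3.7 (ii) (p. 79), Corollary
3.8 (i), (iii) (pp. 80–81) [cite: MochizukiEtTh2009, Thm 3.7 p.79].

PROOF-ONLY companion (abc-iut cell, block F = FACT-LIST fact-proving wave, seat abc-iut-f-015; FACT-LIST
rows **F-0581** `TemperedFrobenioid.Remark363`, **F-0583** `TemperedFrobenioid.Thm37_ii`, **F-0580**
`PreservesBaseFieldTheoretic`, **F-0740** `Cor38_i`, **F-0742** `Cor38_iii`; statement owner abc-iut-L2-t3,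
`TemperedFrobenioidProps.lean`; class `preparatory`, kernel_closedness `parametrised`).  Every one of these
rows is a `Prop`-valued SCHEMA — over the tempered-Frobenioid structure `C₀ : TemperedFrobenioid T D VD`
(whose [FrdI] vocabulary enters through the stub records `V : FrdIMonoidStub`, `VD : FrdICatStub` and, for
Thm. 3.7, the free record `F : FrobenioidFacade D` of predicates), resp. over a Cor. 3.8 hypothesis record
`h : Cor38Hyp C₁ C₂`.  What the kernel can say about the universal closures (level `0`):

* **F-0581 `Remark363`** ("`C^{bs-fld} → C` is isomorphism-full", + the morphism clause): the closure over all
  tempered-Frobenioid structures is FALSE — `not_forall_remark363`, by abc-iut-w5-d135's kernel certificate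
  `ToyFinv.not_remark363` (`TemperedFrobenioidToyFinv.lean`: over the typed Def. 3.3 (iii)/3.6 (i) data with
  `F₀^Λ` NOT inverse-closed the isomorphism `hull(A,0) ⥲ hull(A,𝔭)` does not lift); it HOLDS for every
  structure with sharp `Φ` GIVEN the Prop. 3.4 (ii) constancy clause and inverse-closure of `F₀^Λ`
  (`TemperedFrobenioid.remark363_of_isSharp` / `remark363_of_prop34Cnst`, `Discharge/Sec3Remark363.lean`), and
  — NEW positive model witness — outright on the toy inhabitant `Toy.temperedFrobenioid` of the interface stack
  (`Toy.remark363`: there `F₀^Λ = B₀^Λ ≅ ℤ` is a group).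
* **F-0583 `Thm37_ii`** ("`D` of FSMFF-type, `Φ` non-dilating ⇒ `C` of standard type [rationally standard if
  `Φ` rational]"): the conclusion is the FREE facade predicate `F.IsOfStandardType`, so the closure over all
  `(C₀, F)` is FALSE (`not_forall_thm37_ii`: the all-`False` facade on the toy, whose base `Discrete PUnit` is of
  FSM-, hence FSMFF-type and whose vocabulary reads "non-dilating" as `True`) while the all-`True` facade
  satisfies it (`Toy.thm37_ii_trueFacade`) — R5: a schema in an arbitrary predicate parameter is not a fact;
  the instance forms with THE [FrdI] Def. 3.1/4.5 predicates are abc-iut-w4-d103's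
  `TemperedFrobenioid.isOfStandardType_treeCatVocab` (`Sec3Thm37Standard.lean`) and
  `thm37_ii_ratStd_treeCatVocab` (`Sec3Thm37RatStd.lean`), conditional on `hBmon` ([FrdI] Thm 5.2 preamble).
* **F-0580 / F-0740 / F-0742** (`PreservesBaseFieldTheoretic h`, `Cor38_i IsFrobeniusSlim h`, `Cor38_iii h`):
  positive instances at the identity equivalence `Ψ = 𝟭 C` for EVERY tempered Frobenioid over a base of
  FSMFF-type with non-dilating `Φ` (`preservesBaseFieldTheoretic_refl`, `cor38_i_refl`, `cor38_iii_refl` — by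
  `Iff.rfl`); the general instance forms are abc-iut-L2's `Cor38Hyp.preservesBaseFieldTheoretic_of_rows`,
  `cor38_i_of_rows` (`TemperedFrobenioidCor38Sub.lean`), `cor38_iii_of` / `cor38_iii_of_isOfFSMType`
  (`Discharge/Sec3Cor38iii(FSM).lean`).  Their universal closures (any equivalence `Ψ`) are treated in the
  companion countermodel file of this seat (two tempered-Frobenioid structures on one category).

No definition, no instance; no statement of the paper is strengthened or re-typed; the refutations are
statements about OUR typed interfaces (free predicate parameters / unrecorded printed properties), not about
the tempered Frobenioids of a curve.  HONEST FRAMING: refereed pre-IUT material; nothing here bears on the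
disputed [IUTchIII] Cor. 3.12; no side taken.
-/

namespace Literature.AnabelianGeometry.EtaleTheta

open CategoryTheory Opposite Literature.AlgebraicGeometry.Frobenioids

universe u₀ v₀ u v w

/-! ### F-0581: Remark 3.6.3 -/

namespace Toy

/-- The divisor monoids `Φ(A) = ℕ` of the toy tempered Frobenioid are sharp.
[cite: MochizukiEtTh2009, Def 3.6 p.77] -/
theorem isSharp_divisorMonoid (A : Discrete PUnit.{1}) :
    IsSharp (temperedFrobenioid.divisorMonoid.obj (op A)) := by
  refine ⟨fun a ha => ?_⟩
  have ha' : IsUnit (M := Multiplicative ℕ) (Subtype.val a) :=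
    ha.map (temperedFrobenioid.Φ.carrier (op A)).subtype
  have h1 : Subtype.val a = (1 : Multiplicative ℕ) := by
    obtain ⟨u, hu⟩ := ha'
    have hv : Multiplicative.toAdd (u : Multiplicative ℕ) +
        Multiplicative.toAdd (↑u⁻¹ : Multiplicative ℕ) = 0 :=
      congrArg Multiplicative.toAdd u.mul_inv
    have h0 : Multiplicative.toAdd (u : Multiplicative ℕ) = 0 := by omega
    rw [← hu]
    exact congrArg Multiplicative.ofAdd h0
  exact Subtype.ext h1

/-- **Remark 3.6.3 HOLDS on the toy inhabitant** `Toy.temperedFrobenioid` of the Def. 3.3 (iii) / 3.6 (i) /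
3.6 (ii) interface stack (positive model witness for F-0581): there `F₀^Λ = B₀^Λ ≅ ℤ` is a group, so the
inverse-closure input `hFinv` of `remark363_of_isSharp` holds, and the Prop. 3.4 (ii) constancy clause is
vacuous (`F₀^Λ = ⊤`). [cite: MochizukiEtTh2009, Rmk 3.6.3 p.79] -/
theorem remark363 : temperedFrobenioid.Remark363 :=
  temperedFrobenioid.remark363_of_isSharp isSharp_divisorMonoid (fun _ _ _ _ => trivial)
    fun _ b _ => ⟨(b⁻¹ : Multiplicative ℤ), trivial, inv_mul_cancel (G := Multiplicative ℤ) b⟩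

end Toy

/-- **F-0581 as typed is not a fact over ALL tempered-Frobenioid structures:** the closure
`∀ C₀, C₀.Remark363` (universe level `0`) is FALSE — abc-iut-w5-d135's certificate `ToyFinv.not_remark363`
(inverse-closure of `F₀^Λ`, which print has since `F₀(Y) ≅ L^×`, is not recorded by the typed Def. 3.6 (i)
data and is necessary).  Instance forms: `Toy.remark363`; `TemperedFrobenioid.remark363_of_prop34Cnst`
(given `hFinv`). [cite: MochizukiEtTh2009, Rmk 3.6.3 p.79] -/
theorem TemperedFrobenioid.not_forall_remark363 :
    ¬ ∀ {D₀ : Type} [Category.{0} D₀] {V : FrdIMonoidStub.{0}} {T : RealifiedDivisorMonoids (D₀ := D₀) V}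
        {D : Type} [Category.{0} D] {VD : FrdICatStub.{0, 0, 0} D} (C₀ : TemperedFrobenioid T D VD),
        C₀.Remark363 :=
  fun h => ToyFinv.not_remark363 (h ToyFinv.temperedFrobenioid)

/-! ### F-0583: Theorem 3.7 (ii) -/

/-- **Thm. 3.7 (ii) at the all-`True` facade HOLDS on the toy** (vacuous model witness: the conclusion of the
typed row is the facade's own predicate). [cite: MochizukiEtTh2009, Thm 3.7 p.79] -/
theorem Toy.thm37_ii_trueFacade :
    Toy.temperedFrobenioid.Thm37_ii
      ⟨fun _ => True, fun _ => True, fun _ => True, fun _ => True, fun _ => True, fun _ _ => True,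
        fun _ _ => True⟩ :=
  fun _ _ => ⟨trivial, fun _ => trivial⟩

/-- **Thm. 3.7 (ii) at the all-`False` facade FAILS on the toy**: its base `Discrete PUnit` is of FSMFF-type
and the trivial vocabulary reads "`Φ` non-dilating" as `True`, so the antecedents hold while the facade's
`IsOfStandardType` is `False`. [cite: MochizukiEtTh2009, Thm 3.7 p.79] -/
theorem Toy.not_thm37_ii_falseFacade :
    ¬ Toy.temperedFrobenioid.Thm37_ii
      ⟨fun _ => False, fun _ => False, fun _ => False, fun _ => False, fun _ => False, fun _ _ => False,
        fun _ _ => False⟩ :=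
  fun h => (h PadicFrd.isOfFSMType_discretePUnit.isOfFSMFFType fun _ _ => trivial).1

/-- **F-0583 as typed is not a fact over ALL `(C₀, F)`:** the closure `∀ C₀ F, C₀.Thm37_ii F` (universe
level `0`) is FALSE — the conclusion "of standard type" is the FREE facade field `F.IsOfStandardType` (R5:
schema in an arbitrary predicate parameter).  Instance forms with THE [FrdI] predicates:
`TemperedFrobenioid.isOfStandardType_treeCatVocab`, `thm37_ii_ratStd_treeCatVocab` (conditional on `hBmon`).
[cite: MochizukiEtTh2009, Thm 3.7 p.79] -/
theorem TemperedFrobenioid.not_forall_thm37_ii :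
    ¬ ∀ {D₀ : Type} [Category.{0} D₀] {V : FrdIMonoidStub.{0}} {T : RealifiedDivisorMonoids (D₀ := D₀) V}
        {D : Type} [Category.{0} D] {VD : FrdICatStub.{0, 0, 0} D} (C₀ : TemperedFrobenioid T D VD)
        (F : FrobenioidFacade.{0, 0, 0} D), C₀.Thm37_ii F :=
  fun h => Toy.not_thm37_ii_falseFacade (h Toy.temperedFrobenioid _)

/-! ### F-0580 / F-0740 / F-0742: Corollary 3.8 at the identity equivalence -/

section Corollary38

variable {D₀ : Type u₀} [Category.{v₀} D₀] {V : FrdIMonoidStub.{w}} {T : RealifiedDivisorMonoids (D₀ := D₀) V}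
  {D : Type u} [Category.{v} D] {VD : FrdICatStub.{u, v, w} D} (C : TemperedFrobenioid T D VD)

/-- **`PreservesBaseFieldTheoretic` at `Ψ = 𝟭 C`** (positive instance of F-0580): the identity equivalence of a
tempered Frobenioid over a base of FSMFF-type with non-dilating `Φ` preserves the base-field-theoretic
morphisms. [cite: MochizukiEtTh2009, Cor 3.8 p.80] -/
theorem TemperedFrobenioid.preservesBaseFieldTheoretic_refl (hD : IsOfFSMFFType D)
    (hnd : ∀ (A : Dᵒᵖ) (f : A ⟶ A), V.IsNonDilating (C.Φ.carrier A) (C.Φ.pull f)) :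
    PreservesBaseFieldTheoretic (C₁ := C) (C₂ := C) ⟨.refl, ⟨hD, hD⟩, ⟨hnd, hnd⟩⟩ :=
  fun _ => Iff.rfl

/-- **`Cor38_i` at `Ψ = 𝟭 C`** (positive instance of F-0740), for any reading of "Frobenius-slim".
[cite: MochizukiEtTh2009, Cor 3.8 p.80] -/
theorem TemperedFrobenioid.cor38_i_refl (IsFrobeniusSlim : ∀ (E : Type u) [Category.{v} E], Prop)
    (hD : IsOfFSMFFType D) (hnd : ∀ (A : Dᵒᵖ) (f : A ⟶ A), V.IsNonDilating (C.Φ.carrier A) (C.Φ.pull f)) :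
    Cor38_i (C₁ := C) (C₂ := C) IsFrobeniusSlim ⟨.refl, ⟨hD, hD⟩, ⟨hnd, hnd⟩⟩ :=
  fun _ _ => C.preservesBaseFieldTheoretic_refl hD hnd

/-- **`Cor38_iii` at `Ψ = 𝟭 C`** (positive instance of F-0742): the identity preserves the non-cuspidal and
the cuspidal pre-steps. [cite: MochizukiEtTh2009, Cor 3.8 p.81] -/
theorem TemperedFrobenioid.cor38_iii_refl (hD : IsOfFSMFFType D)
    (hnd : ∀ (A : Dᵒᵖ) (f : A ⟶ A), V.IsNonDilating (C.Φ.carrier A) (C.Φ.pull f)) :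
    Cor38_iii (C₁ := C) (C₂ := C) ⟨.refl, ⟨hD, hD⟩, ⟨hnd, hnd⟩⟩ :=
  fun _ _ _ _ _ _ => ⟨Iff.rfl, Iff.rfl⟩

end Corollary38

end Literature.AnabelianGeometry.EtaleTheta
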